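import Mathlib
import Summits.PneNP.PneNP.Theorems.OverlapGapAlgebraSearchHardWindowSequentialLocalMoment

/-!
# PneNP / OverlapGapAlgebra — `SearchHardWindow` / `SolvableImpliesStableSection`:
# SEQUENTIAL LOCAL RULES are ℓ²-stable (3/4) — light cones along increasing chains; the bound

Support for cruxes `stmt-PneNP-2460` and `stmt-PneNP-2463`. A search map `g` on `F_k(n, m)` is
an INDEX-ORDER DECIMATION RULE WITH UNIT LOOK-AHEAD — hypothesis `hseq`, definition-free — if
its bit at `v` is an arbitrary (label-dependent) function of the labelled clauses containing `v`
and of its own bits at the SMALLER variables occurring in those clauses: Unit-Clause-type rules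
and one-round Warning/Belief-Propagation-guided decimation run in a fixed variable order, the
radius-one "sequential local algorithms" (Gamarnik–Sudan). Such a rule is ADAPTIVE: its bit at
`v` depends on the instance through dependency chains of unbounded length, so it is not a
radius-`r` local rule for any `r`; but the dependencies only DESCEND in label, and a chain
`x₀ < x₁ < ⋯ < x_ℓ` of co-occurring variables is realised with probability `≈ (αk²)^ℓ/ℓ!`.

* `shwSeq_cone` — LIGHT CONE: if `Φ, Φ'` differ in one literal of clause `a`, the outputs differ
  only inside the increasing cone of the variables of clause `a` (old and new);
* `shwSeq_cone_root`, `shwSeq_hamming_sq_le` — hence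
  `d_H(g Φ, g Φ')² ≤ (k + 1)(∑_q T_{∖a}(Φ, (Φ a q).1)² + T(Φ, ℓ.1)²)`;
* `shwSeq_meanSquare` — summing, with the bounded second moment of increasing cones
  (`shwSeq_S2_le`): every such `g` has MEAN-SQUARE single-literal-resample sensitivity
  `∑_{(a,b)} ∑_{(Φ,ℓ)} d_H(g Φ, g Φ[(a,b) ↦ ℓ])² ≤ (k+1)² (1+β) e^{β(1+k²+β)} · (mk) · #Inst · 2n`
  for any `β ≥ mk²/n` — a CONSTANT `s₂ = C(k, α)` at clause density `α`, for every `n`.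
No definitions; axioms `propext`, `Classical.choice`, `Quot.sound`.
-/

set_option linter.dupNamespace false -- `Summit.PneNP.PneNP.…`: summit = sub-problem (D-0017)

namespace Summit.PneNP.PneNP.Theorems

open Finset
open scoped Classical

section SeqSens

variable {m k n : ℕ}

/-- **Light cone of a sequential local rule.** If `g` is an index-order decimation rule with unit
look-ahead and `Φ' = Φ[(a,b) ↦ ℓ]`, then every variable where `g Φ` and `g Φ'` differ is reached
by an increasing co-occurrence chain (in `Φ`) from a variable of clause `a` or from `ℓ.1`. -/
theorem shwSeq_cone (g : (Fin m → Fin k → Fin n × Bool) → (Fin n → Bool)) (hseq : (∀ (Φ Φ' : (Fin m → Fin k → Fin n × Bool)) (v : Fin n),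
        (∀ i : Fin m, ((∃ j : Fin k, (Φ i j).1 = v) ∨ (∃ j : Fin k, (Φ' i j).1 = v)) → Φ i = Φ' i) →
        (∀ (i : Fin m) (j j' : Fin k), (Φ i j).1 = v → (Φ i j').1 < v →
          g Φ (Φ i j').1 = g Φ' (Φ i j').1) →
        g Φ v = g Φ' v)) (Φ : (Fin m → Fin k → Fin n × Bool)) (a : Fin m)
    (b : Fin k) (ℓ : Fin n × Bool) (v : Fin n)
    (hv : g Φ v ≠ g (Function.update Φ a (Function.update (Φ a) b ℓ)) v) :
    (∃ j : Fin k, (∃ (ll : ℕ) (xx : ℕ → Fin n), xx 0 = ((Φ a j).1) ∧ xx ll = v ∧ ∀ ss : ℕ, ss < ll →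
          (xx ss < xx (ss + 1) ∧ ∃ cc ∈ (Finset.univ : Finset (Fin m)), ∃ pp qq : Fin k,
            (Φ cc pp).1 = xx ss ∧ (Φ cc qq).1 = xx (ss + 1)))) ∨
      (∃ (ll : ℕ) (xx : ℕ → Fin n), xx 0 = ℓ.1 ∧ xx ll = v ∧ ∀ ss : ℕ, ss < ll →
          (xx ss < xx (ss + 1) ∧ ∃ cc ∈ (Finset.univ : Finset (Fin m)), ∃ pp qq : Fin k,
            (Φ cc pp).1 = xx ss ∧ (Φ cc qq).1 = xx (ss + 1))) := by
  set Φ' := Function.update Φ a (Function.update (Φ a) b ℓ) with hΦ'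
  -- strong induction on the label
  suffices H : ∀ d : ℕ, ∀ v : Fin n, (v : ℕ) < d → g Φ v ≠ g Φ' v →
      (∃ j : Fin k, (∃ (ll : ℕ) (xx : ℕ → Fin n), xx 0 = ((Φ a j).1) ∧ xx ll = v ∧ ∀ ss : ℕ, ss < ll →
          (xx ss < xx (ss + 1) ∧ ∃ cc ∈ (Finset.univ : Finset (Fin m)), ∃ pp qq : Fin k,
            (Φ cc pp).1 = xx ss ∧ (Φ cc qq).1 = xx (ss + 1)))) ∨
        (∃ (ll : ℕ) (xx : ℕ → Fin n), xx 0 = ℓ.1 ∧ xx ll = v ∧ ∀ ss : ℕ, ss < ll →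
          (xx ss < xx (ss + 1) ∧ ∃ cc ∈ (Finset.univ : Finset (Fin m)), ∃ pp qq : Fin k,
            (Φ cc pp).1 = xx ss ∧ (Φ cc qq).1 = xx (ss + 1))) from H (v + 1) v (Nat.lt_succ_self _) hv
  intro d
  induction d with
  | zero => intro v hv0; exact absurd hv0 (Nat.not_lt_zero _)
  | succ d ih =>
    intro v hvd hne
    by_contra hnot
    rw [not_or, not_exists] at hnot
    apply hne
    apply hseq Φ Φ' v
    · -- the clauses containing `v` agree
      intro i hi
      by_cases hia : i = a
      · exfalso
        subst hia
        rcases hi with ⟨j, hj⟩ | ⟨j, hj⟩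
        · exact hnot.1 j (hj ▸ shwSeq_reach_refl Φ _ _)
        · by_cases hjb : j = b
          · subst hjb
            rw [hΦ', Function.update_self, Function.update_self] at hj
            exact hnot.2 (hj ▸ shwSeq_reach_refl Φ _ _)
          · rw [hΦ', Function.update_self, Function.update_of_ne hjb] at hj
            exact hnot.1 j (hj ▸ shwSeq_reach_refl Φ _ _)
      · rw [hΦ', Function.update_of_ne hia]
    · -- the bits at smaller co-occurring variables agree (induction)
      intro i j j' hij hlt
      by_contra hne'
      have hlt' : (((Φ i j').1 : Fin n) : ℕ) < d := lt_of_lt_of_le (Fin.lt_def.1 hlt) (Nat.lt_succ_iff.1 hvd)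
      rcases ih (Φ i j').1 hlt' hne' with ⟨j₀, hj₀⟩ | hℓ
      · exact hnot.1 j₀ (shwSeq_reach_snoc Φ _ _ _ v i j' j hj₀ hlt (Finset.mem_univ _) rfl hij)
      · exact hnot.2 (shwSeq_reach_snoc Φ _ _ _ v i j' j hℓ hlt (Finset.mem_univ _) rfl hij)

/-- Roots inside clause `a` can be traded for roots of AVOIDING cones (last use of `a`). -/
theorem shwSeq_cone_root (Φ : (Fin m → Fin k → Fin n × Bool)) (a : Fin m) (j : Fin k) (v : Fin n)
    (h : (∃ (ll : ℕ) (xx : ℕ → Fin n), xx 0 = ((Φ a j).1) ∧ xx ll = v ∧ ∀ ss : ℕ, ss < ll →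
          (xx ss < xx (ss + 1) ∧ ∃ cc ∈ (Finset.univ : Finset (Fin m)), ∃ pp qq : Fin k,
            (Φ cc pp).1 = xx ss ∧ (Φ cc qq).1 = xx (ss + 1)))) :
    ∃ q : Fin k, (∃ (ll : ℕ) (xx : ℕ → Fin n), xx 0 = ((Φ a q).1) ∧ xx ll = v ∧ ∀ ss : ℕ, ss < ll →
          (xx ss < xx (ss + 1) ∧ ∃ cc ∈ ((Finset.univ : Finset (Fin m)).erase a), ∃ pp qq : Fin k,
            (Φ cc pp).1 = xx ss ∧ (Φ cc qq).1 = xx (ss + 1))) := by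
  rcases shwSeq_reach_split Φ _ _ v a h with h1 | ⟨_, q, _, _, hq⟩
  · exact ⟨j, h1⟩
  · exact ⟨q, hq⟩

/-- **Bounded differences through the cone.**
`d_H(g Φ, g Φ[(a,b) ↦ ℓ])² ≤ (k + 1)(∑_q T_{∖a}(Φ, (Φ a q).1)² + T(Φ, ℓ.1)²)`. -/
theorem shwSeq_hamming_sq_le (g : (Fin m → Fin k → Fin n × Bool) → (Fin n → Bool)) (hseq : (∀ (Φ Φ' : (Fin m → Fin k → Fin n × Bool)) (v : Fin n),
        (∀ i : Fin m, ((∃ j : Fin k, (Φ i j).1 = v) ∨ (∃ j : Fin k, (Φ' i j).1 = v)) → Φ i = Φ' i) →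
        (∀ (i : Fin m) (j j' : Fin k), (Φ i j).1 = v → (Φ i j').1 < v →
          g Φ (Φ i j').1 = g Φ' (Φ i j').1) →
        g Φ v = g Φ' v)) (Φ : (Fin m → Fin k → Fin n × Bool))
    (a : Fin m) (b : Fin k) (ℓ : Fin n × Bool) :
    ((hammingDist (g Φ) (g (Function.update Φ a (Function.update (Φ a) b ℓ))) : ℕ) : ℝ) ^ 2 ≤
      ((k : ℝ) + 1) * (∑ q : Fin k,
        ((((Finset.univ : Finset (Fin n)).filter fun ww => (∃ (ll : ℕ) (xx : ℕ → Fin n), xx 0 = ((Φ a q).1) ∧ xx ll = ww ∧ ∀ ss : ℕ, ss < ll →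
          (xx ss < xx (ss + 1) ∧ ∃ cc ∈ ((Finset.univ : Finset (Fin m)).erase a), ∃ pp qq : Fin k,
            (Φ cc pp).1 = xx ss ∧ (Φ cc qq).1 = xx (ss + 1)))).card : ℕ) : ℝ) ^ 2 +
        ((((Finset.univ : Finset (Fin n)).filter fun ww => (∃ (ll : ℕ) (xx : ℕ → Fin n), xx 0 = ℓ.1 ∧ xx ll = ww ∧ ∀ ss : ℕ, ss < ll →
          (xx ss < xx (ss + 1) ∧ ∃ cc ∈ (Finset.univ : Finset (Fin m)), ∃ pp qq : Fin k,
            (Φ cc pp).1 = xx ss ∧ (Φ cc qq).1 = xx (ss + 1)))).card : ℕ) : ℝ) ^ 2) := by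
  set Φ' := Function.update Φ a (Function.update (Φ a) b ℓ) with hΦ'
  set Ra : Fin k → Finset (Fin n) := fun q => (Finset.univ : Finset (Fin n)).filter fun ww =>
      (∃ (ll : ℕ) (xx : ℕ → Fin n), xx 0 = ((Φ a q).1) ∧ xx ll = ww ∧ ∀ ss : ℕ, ss < ll →
          (xx ss < xx (ss + 1) ∧ ∃ cc ∈ ((Finset.univ : Finset (Fin m)).erase a), ∃ pp qq : Fin k,
            (Φ cc pp).1 = xx ss ∧ (Φ cc qq).1 = xx (ss + 1))) with hRa
  set Rl : Finset (Fin n) := (Finset.univ : Finset (Fin n)).filter fun ww =>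
      (∃ (ll : ℕ) (xx : ℕ → Fin n), xx 0 = ℓ.1 ∧ xx ll = ww ∧ ∀ ss : ℕ, ss < ll →
          (xx ss < xx (ss + 1) ∧ ∃ cc ∈ (Finset.univ : Finset (Fin m)), ∃ pp qq : Fin k,
            (Φ cc pp).1 = xx ss ∧ (Φ cc qq).1 = xx (ss + 1))) with hRl
  -- the difference set sits inside the cones
  have hsub : ((Finset.univ : Finset (Fin n)).filter fun v => g Φ v ≠ g Φ' v) ⊆
      (Finset.univ : Finset (Fin k)).biUnion Ra ∪ Rl := by
    intro v hv
    rw [Finset.mem_filter] at hv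
    rcases shwSeq_cone g hseq Φ a b ℓ v hv.2 with ⟨j, hj⟩ | hℓ
    · obtain ⟨q, hq⟩ := shwSeq_cone_root Φ a j v hj
      exact Finset.mem_union_left _ (Finset.mem_biUnion.2 ⟨q, Finset.mem_univ _,
        Finset.mem_filter.2 ⟨Finset.mem_univ _, hq⟩⟩)
    · exact Finset.mem_union_right _ (Finset.mem_filter.2 ⟨Finset.mem_univ _, hℓ⟩)
  have hcard : hammingDist (g Φ) (g Φ') ≤ ∑ q : Fin k, (Ra q).card + Rl.card := by
    calc hammingDist (g Φ) (g Φ')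
        = ((Finset.univ : Finset (Fin n)).filter fun v => g Φ v ≠ g Φ' v).card := rfl
      _ ≤ ((Finset.univ : Finset (Fin k)).biUnion Ra ∪ Rl).card := Finset.card_le_card hsub
      _ ≤ ((Finset.univ : Finset (Fin k)).biUnion Ra).card + Rl.card := Finset.card_union_le _ _
      _ ≤ ∑ q : Fin k, (Ra q).card + Rl.card := Nat.add_le_add_right Finset.card_biUnion_le _
  -- Cauchy–Schwarz over `Option (Fin k)`
  set x : Option (Fin k) → ℝ := fun o => Option.elim o (Rl.card : ℝ) (fun q => ((Ra q).card : ℝ))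
    with hx
  have hsumx : ∑ o : Option (Fin k), x o = Rl.card + ∑ q : Fin k, ((Ra q).card : ℝ) := by
    rw [Fintype.sum_option]; rfl
  have hsumx2 : ∑ o : Option (Fin k), x o ^ 2 = (Rl.card : ℝ) ^ 2 + ∑ q : Fin k, ((Ra q).card : ℝ) ^ 2 := by
    rw [Fintype.sum_option]; rfl
  have hcs : (∑ o : Option (Fin k), x o) ^ 2 ≤
      (Finset.univ : Finset (Option (Fin k))).card * ∑ o : Option (Fin k), x o ^ 2 :=
    sq_sum_le_card_mul_sum_sq
  rw [Finset.card_univ, Fintype.card_option, Fintype.card_fin, hsumx, hsumx2] at hcs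
  have hR : ((hammingDist (g Φ) (g Φ') : ℕ) : ℝ) ≤ Rl.card + ∑ q : Fin k, ((Ra q).card : ℝ) := by
    have h' : ((hammingDist (g Φ) (g Φ') : ℕ) : ℝ) ≤ ((∑ q : Fin k, (Ra q).card + Rl.card : ℕ) : ℝ) := by
      exact_mod_cast hcard
    push_cast at h'
    linarith [h']
  have h0 : (0 : ℝ) ≤ ((hammingDist (g Φ) (g Φ') : ℕ) : ℝ) := Nat.cast_nonneg _
  calc ((hammingDist (g Φ) (g Φ') : ℕ) : ℝ) ^ 2
      ≤ (Rl.card + ∑ q : Fin k, ((Ra q).card : ℝ)) ^ 2 := pow_le_pow_left₀ h0 hR 2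
    _ ≤ ((k + 1 : ℕ) : ℝ) * ((Rl.card : ℝ) ^ 2 + ∑ q : Fin k, ((Ra q).card : ℝ) ^ 2) := hcs
    _ = ((k : ℝ) + 1) * (∑ q : Fin k, ((Ra q).card : ℝ) ^ 2 + (Rl.card : ℝ) ^ 2) := by
        push_cast; ring

/-- **Sequential local rules are ℓ²-stable, with a constant.** For `1 ≤ n` and `mk² ≤ βn`, every
index-order decimation rule with unit look-ahead `g` on `F_k(n, m)` satisfies
`∑_{(a,b)} ∑_{(Φ,ℓ)} d_H(g Φ, g Φ[(a,b) ↦ ℓ])² ≤ (k+1)² (1+β) e^{β(1+k²+β)} · (mk) · #Inst · 2n`. -/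
theorem shwSeq_meanSquare (hn : 1 ≤ n) (β : ℝ) (hβ : (m : ℝ) * (k : ℝ) ^ 2 ≤ β * n)
    (g : (Fin m → Fin k → Fin n × Bool) → (Fin n → Bool)) (hseq : (∀ (Φ Φ' : (Fin m → Fin k → Fin n × Bool)) (v : Fin n),
        (∀ i : Fin m, ((∃ j : Fin k, (Φ i j).1 = v) ∨ (∃ j : Fin k, (Φ' i j).1 = v)) → Φ i = Φ' i) →
        (∀ (i : Fin m) (j j' : Fin k), (Φ i j).1 = v → (Φ i j').1 < v →
          g Φ (Φ i j').1 = g Φ' (Φ i j').1) →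
        g Φ v = g Φ' v)) :
    (∑ a : Fin m, ∑ b : Fin k, ∑ p : (Fin m → Fin k → Fin n × Bool) × (Fin n × Bool),
        (hammingDist (g p.1) (g (Function.update p.1 a (Function.update (p.1 a) b p.2))) : ℝ) ^ 2)
      ≤ (((k : ℝ) + 1) ^ 2 * ((1 + β) * Real.exp (β * (1 + (k : ℝ) ^ 2 + β))))
          * (((m * k : ℕ) : ℝ) * (Fintype.card (Fin m → Fin k → Fin n × Bool) * (2 * n))) := by
  have hnpos : (0 : ℝ) < n := by exact_mod_cast hn
  set β₀ : ℝ := (m : ℝ) * (k : ℝ) ^ 2 / n with hβ₀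
  have hβ₀β : β₀ ≤ β := by rw [hβ₀, div_le_iff₀ hnpos]; exact hβ
  have hβ₀0 : 0 ≤ β₀ := by rw [hβ₀]; positivity
  set K₀ : ℝ := (1 + β₀) * Real.exp (β₀ * (1 + (k : ℝ) ^ 2 + β₀)) with hK₀
  set K : ℝ := (1 + β) * Real.exp (β * (1 + (k : ℝ) ^ 2 + β)) with hK
  set N : ℝ := (Fintype.card (Fin m → Fin k → Fin n × Bool) : ℝ) with hN
  have hK₀K : K₀ ≤ K := by
    rw [hK₀, hK]
    have h1 : 1 + β₀ ≤ 1 + β := by linarith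
    have h2 : Real.exp (β₀ * (1 + (k : ℝ) ^ 2 + β₀)) ≤ Real.exp (β * (1 + (k : ℝ) ^ 2 + β)) := by
      rw [Real.exp_le_exp]
      have : 0 ≤ 1 + (k : ℝ) ^ 2 + β₀ := by positivity
      nlinarith
    exact mul_le_mul h1 h2 (Real.exp_pos _).le (by linarith)
  -- the second-moment bound for every root
  have hS2 : ∀ w : Fin n, (∑ Φ : (Fin m → Fin k → Fin n × Bool), ((((Finset.univ : Finset (Fin n)).filter fun ww => (∃ (ll : ℕ) (xx : ℕ → Fin n), xx 0 = w ∧ xx ll = ww ∧ ∀ ss : ℕ, ss < ll →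
          (xx ss < xx (ss + 1) ∧ ∃ cc ∈ (Finset.univ : Finset (Fin m)), ∃ pp qq : Fin k,
            (Φ cc pp).1 = xx ss ∧ (Φ cc qq).1 = xx (ss + 1)))).card : ℕ) : ℝ) ^ 2) ≤ K₀ * N := fun w => by
    have := shwSeq_S2_le (m := m) (k := k) hn w
    rw [hK₀, hN]; exact this
  -- (i) the new literal's cone: `∑_Φ ∑_ℓ T(Φ, ℓ.1)² ≤ 2n K₀ N`
  have hlit : ∑ Φ : (Fin m → Fin k → Fin n × Bool), ∑ ℓ : Fin n × Bool,
      ((((Finset.univ : Finset (Fin n)).filter fun ww => (∃ (ll : ℕ) (xx : ℕ → Fin n), xx 0 = ℓ.1 ∧ xx ll = ww ∧ ∀ ss : ℕ, ss < ll →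
          (xx ss < xx (ss + 1) ∧ ∃ cc ∈ (Finset.univ : Finset (Fin m)), ∃ pp qq : Fin k,
            (Φ cc pp).1 = xx ss ∧ (Φ cc qq).1 = xx (ss + 1)))).card : ℕ) : ℝ) ^ 2 ≤ 2 * n * (K₀ * N) := by
    rw [Finset.sum_comm]
    calc ∑ ℓ : Fin n × Bool, ∑ Φ : (Fin m → Fin k → Fin n × Bool), ((((Finset.univ : Finset (Fin n)).filter fun ww => (∃ (ll : ℕ) (xx : ℕ → Fin n), xx 0 = ℓ.1 ∧ xx ll = ww ∧ ∀ ss : ℕ, ss < ll →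
          (xx ss < xx (ss + 1) ∧ ∃ cc ∈ (Finset.univ : Finset (Fin m)), ∃ pp qq : Fin k,
            (Φ cc pp).1 = xx ss ∧ (Φ cc qq).1 = xx (ss + 1)))).card : ℕ) : ℝ) ^ 2
        ≤ ∑ _ℓ : Fin n × Bool, K₀ * N := Finset.sum_le_sum fun ℓ _ => hS2 ℓ.1
      _ = 2 * n * (K₀ * N) := by
          rw [Finset.sum_const, Finset.card_univ, nsmul_eq_mul, Fintype.card_prod, Fintype.card_fin,
            Fintype.card_bool]
          push_cast; ring
  -- (ii) the cones of the old variables of clause `a`: `∑_Φ T_{∖a}(Φ, (Φ a q).1)² ≤ K₀ N`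
  have hold : ∀ (a : Fin m) (q : Fin k), ∑ Φ : (Fin m → Fin k → Fin n × Bool),
      ((((Finset.univ : Finset (Fin n)).filter fun ww => (∃ (ll : ℕ) (xx : ℕ → Fin n), xx 0 = ((Φ a q).1) ∧ xx ll = ww ∧ ∀ ss : ℕ, ss < ll →
          (xx ss < xx (ss + 1) ∧ ∃ cc ∈ ((Finset.univ : Finset (Fin m)).erase a), ∃ pp qq : Fin k,
            (Φ cc pp).1 = xx ss ∧ (Φ cc qq).1 = xx (ss + 1)))).card : ℕ) : ℝ) ^ 2 ≤ K₀ * N := by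
    intro a q
    -- insert the root `w = (Φ a q).1` and factor the slot `(a, q)`
    have hins : ∀ Φ : (Fin m → Fin k → Fin n × Bool), ((((Finset.univ : Finset (Fin n)).filter fun ww => (∃ (ll : ℕ) (xx : ℕ → Fin n), xx 0 = ((Φ a q).1) ∧ xx ll = ww ∧ ∀ ss : ℕ, ss < ll →
          (xx ss < xx (ss + 1) ∧ ∃ cc ∈ ((Finset.univ : Finset (Fin m)).erase a), ∃ pp qq : Fin k,
            (Φ cc pp).1 = xx ss ∧ (Φ cc qq).1 = xx (ss + 1)))).card : ℕ) : ℝ) ^ 2 =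
        ∑ w : Fin n, (if (Φ a q).1 = w then
          ((((Finset.univ : Finset (Fin n)).filter fun ww => (∃ (ll : ℕ) (xx : ℕ → Fin n), xx 0 = w ∧ xx ll = ww ∧ ∀ ss : ℕ, ss < ll →
          (xx ss < xx (ss + 1) ∧ ∃ cc ∈ ((Finset.univ : Finset (Fin m)).erase a), ∃ pp qq : Fin k,
            (Φ cc pp).1 = xx ss ∧ (Φ cc qq).1 = xx (ss + 1)))).card : ℕ) : ℝ) ^ 2 else 0) := by
      intro Φ
      rw [Finset.sum_ite_eq]
      simp only [Finset.mem_univ, if_true]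
    rw [Finset.sum_congr rfl fun Φ _ => hins Φ, Finset.sum_comm]
    have hw : ∀ w : Fin n, ∑ Φ : (Fin m → Fin k → Fin n × Bool), (if (Φ a q).1 = w then
        ((((Finset.univ : Finset (Fin n)).filter fun ww => (∃ (ll : ℕ) (xx : ℕ → Fin n), xx 0 = w ∧ xx ll = ww ∧ ∀ ss : ℕ, ss < ll →
          (xx ss < xx (ss + 1) ∧ ∃ cc ∈ ((Finset.univ : Finset (Fin m)).erase a), ∃ pp qq : Fin k,
            (Φ cc pp).1 = xx ss ∧ (Φ cc qq).1 = xx (ss + 1)))).card : ℕ) : ℝ) ^ 2 else 0) = (1 / n) * ∑ Φ : (Fin m → Fin k → Fin n × Bool), ((((Finset.univ : Finset (Fin n)).filter fun ww => (∃ (ll : ℕ) (xx : ℕ → Fin n), xx 0 = w ∧ xx ll = ww ∧ ∀ ss : ℕ, ss < ll →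
          (xx ss < xx (ss + 1) ∧ ∃ cc ∈ ((Finset.univ : Finset (Fin m)).erase a), ∃ pp qq : Fin k,
            (Φ cc pp).1 = xx ss ∧ (Φ cc qq).1 = xx (ss + 1)))).card : ℕ) : ℝ) ^ 2 := by
      intro w
      have h := shwSeq_sum_slot_indicator a q w
        (fun Φ => ((((Finset.univ : Finset (Fin n)).filter fun ww => (∃ (ll : ℕ) (xx : ℕ → Fin n), xx 0 = w ∧ xx ll = ww ∧ ∀ ss : ℕ, ss < ll →
          (xx ss < xx (ss + 1) ∧ ∃ cc ∈ ((Finset.univ : Finset (Fin m)).erase a), ∃ pp qq : Fin k,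
            (Φ cc pp).1 = xx ss ∧ (Φ cc qq).1 = xx (ss + 1)))).card : ℕ) : ℝ) ^ 2)
        (fun Φ ℓ' => by simp only [shwSeq_T_erase_update])
      rw [← Finset.sum_filter, one_div, inv_mul_eq_div, eq_div_iff hnpos.ne', mul_comm]
      exact h
    rw [Finset.sum_congr rfl fun w _ => hw w, ← Finset.mul_sum]
    have hmono : ∑ w : Fin n, ∑ Φ : (Fin m → Fin k → Fin n × Bool),
        ((((Finset.univ : Finset (Fin n)).filter fun ww => (∃ (ll : ℕ) (xx : ℕ → Fin n), xx 0 = w ∧ xx ll = ww ∧ ∀ ss : ℕ, ss < ll →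
          (xx ss < xx (ss + 1) ∧ ∃ cc ∈ ((Finset.univ : Finset (Fin m)).erase a), ∃ pp qq : Fin k,
            (Φ cc pp).1 = xx ss ∧ (Φ cc qq).1 = xx (ss + 1)))).card : ℕ) : ℝ) ^ 2 ≤ ∑ w : Fin n, K₀ * N := by
      refine Finset.sum_le_sum fun w _ => le_trans (Finset.sum_le_sum fun Φ _ => ?_) (hS2 w)
      refine pow_le_pow_left₀ (Nat.cast_nonneg _) ?_ 2
      exact_mod_cast Finset.card_le_card (fun x hx => by
        rw [Finset.mem_filter] at hx ⊢
        exact ⟨hx.1, shwSeq_reach_mono Φ _ _ (Finset.erase_subset _ _) w x hx.2⟩)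
    calc (1 / (n : ℝ)) * ∑ w : Fin n, ∑ Φ : (Fin m → Fin k → Fin n × Bool),
          ((((Finset.univ : Finset (Fin n)).filter fun ww => (∃ (ll : ℕ) (xx : ℕ → Fin n), xx 0 = w ∧ xx ll = ww ∧ ∀ ss : ℕ, ss < ll →
          (xx ss < xx (ss + 1) ∧ ∃ cc ∈ ((Finset.univ : Finset (Fin m)).erase a), ∃ pp qq : Fin k,
            (Φ cc pp).1 = xx ss ∧ (Φ cc qq).1 = xx (ss + 1)))).card : ℕ) : ℝ) ^ 2
        ≤ (1 / (n : ℝ)) * ∑ _w : Fin n, K₀ * N := mul_le_mul_of_nonneg_left hmono (by positivity)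
      _ = K₀ * N := by
          rw [Finset.sum_const, Finset.card_univ, Fintype.card_fin, nsmul_eq_mul]
          field_simp
  -- (iii) per `(a, b)`
  have hab : ∀ (a : Fin m) (b : Fin k), ∑ p : (Fin m → Fin k → Fin n × Bool) × (Fin n × Bool),
      ((hammingDist (g p.1) (g (Function.update p.1 a (Function.update (p.1 a) b p.2))) : ℕ) : ℝ) ^ 2 ≤
        ((k : ℝ) + 1) ^ 2 * K₀ * (N * (2 * n)) := by
    intro a b
    rw [Fintype.sum_prod_type]
    calc ∑ Φ : (Fin m → Fin k → Fin n × Bool), ∑ ℓ : Fin n × Bool,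
          ((hammingDist (g Φ) (g (Function.update Φ a (Function.update (Φ a) b ℓ))) : ℕ) : ℝ) ^ 2
        ≤ ∑ Φ : (Fin m → Fin k → Fin n × Bool), ∑ ℓ : Fin n × Bool, ((k : ℝ) + 1) * (∑ q : Fin k,
            ((((Finset.univ : Finset (Fin n)).filter fun ww => (∃ (ll : ℕ) (xx : ℕ → Fin n), xx 0 = ((Φ a q).1) ∧ xx ll = ww ∧ ∀ ss : ℕ, ss < ll →
          (xx ss < xx (ss + 1) ∧ ∃ cc ∈ ((Finset.univ : Finset (Fin m)).erase a), ∃ pp qq : Fin k,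
            (Φ cc pp).1 = xx ss ∧ (Φ cc qq).1 = xx (ss + 1)))).card : ℕ) : ℝ) ^ 2 +
            ((((Finset.univ : Finset (Fin n)).filter fun ww => (∃ (ll : ℕ) (xx : ℕ → Fin n), xx 0 = ℓ.1 ∧ xx ll = ww ∧ ∀ ss : ℕ, ss < ll →
          (xx ss < xx (ss + 1) ∧ ∃ cc ∈ (Finset.univ : Finset (Fin m)), ∃ pp qq : Fin k,
            (Φ cc pp).1 = xx ss ∧ (Φ cc qq).1 = xx (ss + 1)))).card : ℕ) : ℝ) ^ 2) :=
          Finset.sum_le_sum fun Φ _ => Finset.sum_le_sum fun ℓ _ => shwSeq_hamming_sq_le g hseq Φ a b ℓ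
      _ = ((k : ℝ) + 1) * ((2 * n) * ∑ Φ : (Fin m → Fin k → Fin n × Bool), ∑ q : Fin k,
            ((((Finset.univ : Finset (Fin n)).filter fun ww => (∃ (ll : ℕ) (xx : ℕ → Fin n), xx 0 = ((Φ a q).1) ∧ xx ll = ww ∧ ∀ ss : ℕ, ss < ll →
          (xx ss < xx (ss + 1) ∧ ∃ cc ∈ ((Finset.univ : Finset (Fin m)).erase a), ∃ pp qq : Fin k,
            (Φ cc pp).1 = xx ss ∧ (Φ cc qq).1 = xx (ss + 1)))).card : ℕ) : ℝ) ^ 2 +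
            ∑ Φ : (Fin m → Fin k → Fin n × Bool), ∑ ℓ : Fin n × Bool, ((((Finset.univ : Finset (Fin n)).filter fun ww => (∃ (ll : ℕ) (xx : ℕ → Fin n), xx 0 = ℓ.1 ∧ xx ll = ww ∧ ∀ ss : ℕ, ss < ll →
          (xx ss < xx (ss + 1) ∧ ∃ cc ∈ (Finset.univ : Finset (Fin m)), ∃ pp qq : Fin k,
            (Φ cc pp).1 = xx ss ∧ (Φ cc qq).1 = xx (ss + 1)))).card : ℕ) : ℝ) ^ 2) := by
          have inner : ∀ Φ : (Fin m → Fin k → Fin n × Bool), ∑ ℓ : Fin n × Bool, ((k : ℝ) + 1) * (∑ q : Fin k,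
              ((((Finset.univ : Finset (Fin n)).filter fun ww => (∃ (ll : ℕ) (xx : ℕ → Fin n), xx 0 = ((Φ a q).1) ∧ xx ll = ww ∧ ∀ ss : ℕ, ss < ll →
          (xx ss < xx (ss + 1) ∧ ∃ cc ∈ ((Finset.univ : Finset (Fin m)).erase a), ∃ pp qq : Fin k,
            (Φ cc pp).1 = xx ss ∧ (Φ cc qq).1 = xx (ss + 1)))).card : ℕ) : ℝ) ^ 2 +
              ((((Finset.univ : Finset (Fin n)).filter fun ww => (∃ (ll : ℕ) (xx : ℕ → Fin n), xx 0 = ℓ.1 ∧ xx ll = ww ∧ ∀ ss : ℕ, ss < ll →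
          (xx ss < xx (ss + 1) ∧ ∃ cc ∈ (Finset.univ : Finset (Fin m)), ∃ pp qq : Fin k,
            (Φ cc pp).1 = xx ss ∧ (Φ cc qq).1 = xx (ss + 1)))).card : ℕ) : ℝ) ^ 2) =
              ((k : ℝ) + 1) * ((2 * n) * ∑ q : Fin k,
                ((((Finset.univ : Finset (Fin n)).filter fun ww => (∃ (ll : ℕ) (xx : ℕ → Fin n), xx 0 = ((Φ a q).1) ∧ xx ll = ww ∧ ∀ ss : ℕ, ss < ll →
          (xx ss < xx (ss + 1) ∧ ∃ cc ∈ ((Finset.univ : Finset (Fin m)).erase a), ∃ pp qq : Fin k,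
            (Φ cc pp).1 = xx ss ∧ (Φ cc qq).1 = xx (ss + 1)))).card : ℕ) : ℝ) ^ 2 +
              ∑ ℓ : Fin n × Bool, ((((Finset.univ : Finset (Fin n)).filter fun ww => (∃ (ll : ℕ) (xx : ℕ → Fin n), xx 0 = ℓ.1 ∧ xx ll = ww ∧ ∀ ss : ℕ, ss < ll →
          (xx ss < xx (ss + 1) ∧ ∃ cc ∈ (Finset.univ : Finset (Fin m)), ∃ pp qq : Fin k,
            (Φ cc pp).1 = xx ss ∧ (Φ cc qq).1 = xx (ss + 1)))).card : ℕ) : ℝ) ^ 2) := by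
            intro Φ
            rw [← Finset.mul_sum, Finset.sum_add_distrib, Finset.sum_const, Finset.card_univ,
              Fintype.card_prod, Fintype.card_fin, Fintype.card_bool, nsmul_eq_mul]
            push_cast; ring
          rw [Finset.sum_congr rfl fun Φ _ => inner Φ, ← Finset.mul_sum, Finset.sum_add_distrib,
            ← Finset.mul_sum]
      _ ≤ ((k : ℝ) + 1) * ((2 * n) * (k * (K₀ * N)) + 2 * n * (K₀ * N)) := by
          apply mul_le_mul_of_nonneg_left _ (by positivity)
          apply add_le_add _ hlit
          apply mul_le_mul_of_nonneg_left _ (by positivity)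
          rw [Finset.sum_comm]
          calc ∑ q : Fin k, ∑ Φ : (Fin m → Fin k → Fin n × Bool),
              ((((Finset.univ : Finset (Fin n)).filter fun ww => (∃ (ll : ℕ) (xx : ℕ → Fin n), xx 0 = ((Φ a q).1) ∧ xx ll = ww ∧ ∀ ss : ℕ, ss < ll →
          (xx ss < xx (ss + 1) ∧ ∃ cc ∈ ((Finset.univ : Finset (Fin m)).erase a), ∃ pp qq : Fin k,
            (Φ cc pp).1 = xx ss ∧ (Φ cc qq).1 = xx (ss + 1)))).card : ℕ) : ℝ) ^ 2
              ≤ ∑ _q : Fin k, K₀ * N := Finset.sum_le_sum fun q _ => hold a q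
            _ = k * (K₀ * N) := by rw [Finset.sum_const, Finset.card_univ, Fintype.card_fin, nsmul_eq_mul]
      _ = ((k : ℝ) + 1) ^ 2 * K₀ * (N * (2 * n)) := by ring
  -- (iv) sum over `(a, b)` and relax `K₀ ≤ K`
  have hNn : 0 ≤ N * (2 * n) := by rw [hN]; positivity
  calc (∑ a : Fin m, ∑ b : Fin k, ∑ p : (Fin m → Fin k → Fin n × Bool) × (Fin n × Bool),
        ((hammingDist (g p.1) (g (Function.update p.1 a (Function.update (p.1 a) b p.2))) : ℕ) : ℝ) ^ 2)
      ≤ ∑ _a : Fin m, ∑ _b : Fin k, ((k : ℝ) + 1) ^ 2 * K₀ * (N * (2 * n)) :=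
        Finset.sum_le_sum fun a _ => Finset.sum_le_sum fun b _ => hab a b
    _ = ((k : ℝ) + 1) ^ 2 * K₀ * (((m * k : ℕ) : ℝ) * (N * (2 * n))) := by
        rw [Finset.sum_const, Finset.sum_const, Finset.card_univ, Finset.card_univ, Fintype.card_fin,
          Fintype.card_fin, smul_smul, nsmul_eq_mul]
        push_cast; ring
    _ ≤ ((k : ℝ) + 1) ^ 2 * K * (((m * k : ℕ) : ℝ) * (N * (2 * n))) := by
        apply mul_le_mul_of_nonneg_right _ (by positivity)
        exact mul_le_mul_of_nonneg_left hK₀K (by positivity)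
    _ = (((k : ℝ) + 1) ^ 2 * ((1 + β) * Real.exp (β * (1 + (k : ℝ) ^ 2 + β))))
          * (((m * k : ℕ) : ℝ) * (N * (2 * n))) := by rw [hK]

end SeqSens

end Summit.PneNP.PneNP.Theorems
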